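import Summits.CriticalPhenomena.CardyFormulaZ2.Theorems.CardySusyWardParafermionFamiliesToSLESixAnchorDataLattice

/-!
# The concrete anchor family (skeleton r4 of line `strip-anchored-vertex-normalisation`,
# crux stmt-CriticalPhenomena-10814), IV: classification of the wall corners of `anchorData δ`

Registered sub-goal `stub_anchorWallClassification` of the stub `stub_anchorMoment_of_IP`. Pure lattice
combinatorics, no probability. The boundary first moment `momentSum` sums over the WALL CORNERS `(p, k)`
of `S_max`: `p = (x, i)` a random both-faces-inner medial vertex (`IsRandomMV`) of `E = anchorData δ`
whose twin medial vertex across the `k`-th corner (`HalfCRGreen.twin`) is not. In the coordinates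
`s = x₀ + x₁` (level), `d = x₀ - x₁` (column) of the lattice diamond `{|s| ≤ L, |d| ≤ L}`
(`L δ < 2 ≤ (L + 1) δ`):

* `AnchorWall.faces_inner_iff_zero/one`: both faces of the edge `s(x, x + eᵢ)` are inner iff
  `-(L-1) ≤ s ≤ L-2` and `-(L-1) ≤ d ≤ L-2` (horizontal), resp. `-(L-2) ≤ d ≤ L-1` (vertical)
  (`S5.isInnerFace_anchor_iff` at the two faces `x`, `x - e_{1-i}`);
* `AnchorWall.isRandomMV_iff_zero/one`: `(x, i)` is random-both-inner iff, moreover, the far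
  endpoint `x + eᵢ` is no `B`-site, i.e. `¬ (s = L-2 ∧ |d ± 1| ≤ L-3)` — the edge condition and the
  "not `A`–`A`" condition are then automatic (an `A`–`A` edge with both faces inner would join the
  layers `s, d = -(L-1)` and `s, d = L-2`, impossible by parity); by `AnchorLattice.mem_zdArcA_iff`,
  `mem_zdArcB_iff`, `S5.mem_zdBoundary_anchor_iff`, `S5.discreteDomainGraph_anchor_adj_iff`, `omega`;
* `stub_anchorWallClassification`: hence, after `fin_cases i <;> fin_cases k` and the twin table,
  every wall corner lies in one of the eight explicit families (free side `s = +L`: `k = 1` at level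
  `s = L-3`; wired sides `d = +L`: `k = 2` at `d = L-2` / `L-1`; `d = -L`: `k = 0` at
  `d = -(L-1)` / `-(L-2)`; `s = -L`: `k = 3` at `s = -(L-1)`) or within distance `8` of a vertex of
  the diamond (`L - 8 ≤ |s|`, `L - 8 ≤ |d|`), by `omega`.

All elementary. [folklore]
-/

noncomputable section

namespace Summit.CriticalPhenomena.CardyFormulaZ2.Theorems.ParafermionFamiliesToSLESix.StripAnchored

open MeasureTheory Filter Set Metric
open scoped Topology BigOperators
open Literature.Probability.LatticeModels
open Literature.Probability.Percolation (bondPercolation half BondConfig)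
open Literature.Probability.RandomPlanarGeometry (DobrushinDomain)
open Literature.Barriers.CriticalPhenomena (medialCornersAt medialVertexOf)
open Literature.Barriers.CriticalPhenomena.HalfCRGreen (coeff twin)
open Summit.CriticalPhenomena.CardyFormulaZ2.Theorems.ParafermionPrecompact.Negative (IsFamily VanishesOn)
open Summit.CriticalPhenomena.CardyFormulaZ2.Cruxes.EdgePrecompact.QkzStripBoundaryArm (cornerObs)
open S5 (anchorDomain)

namespace AnchorWall

variable {δ : ℝ} {L : ℤ}

/-! ## The two faces of a lattice edge of the diamond -/

/-- The faces of the horizontal edge `s(x, x + e₀)` are `x` and `x - e₁`; both are inner faces of the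
anchor data iff `-(L-1) ≤ s ≤ L-2` and `-(L-1) ≤ d ≤ L-2` (`s = x₀ + x₁`, `d = x₀ - x₁`). [folklore] -/
theorem faces_inner_iff_zero (hδ : 0 < δ) (hLδ : (L : ℝ) * δ < 2) (hL1 : 2 ≤ ((L : ℝ) + 1) * δ)
    (x : Site 2) :
    (∀ f : Site 2, IsCorner x f → IsCorner (x + Pi.single 0 1) f → (anchorData δ).IsInnerFace f) ↔
      -(L - 1) ≤ x 0 + x 1 ∧ x 0 + x 1 ≤ L - 2 ∧ -(L - 1) ≤ x 0 - x 1 ∧ x 0 - x 1 ≤ L - 2 := by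
  have hinner := S5.isInnerFace_anchor_iff (E := anchorData δ) rfl rfl hδ hLδ hL1
  constructor
  · intro h
    have h1 := h x (isCorner_self x) (S5.anchor_isCorner_add_single x 0)
    have h2 := h (x - Pi.single 1 1) (fun j => by fin_cases j <;> simp)
      (fun j => by fin_cases j <;> simp)
    rw [hinner] at h1 h2
    simp only [Pi.sub_apply, Pi.single_eq_same, ne_eq, not_false_eq_true,
      Pi.single_eq_of_ne, zero_ne_one, sub_zero] at h2
    simp only [abs_lt] at h1 h2
    omega
  · rintro ⟨h1, h2, h3, h4⟩ f hf hf'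
    have a0 := hf 0
    have a1 := hf 1
    have b0 := hf' 0
    have b1 := hf' 1
    simp only [Pi.add_apply, Pi.single_eq_same, ne_eq, one_ne_zero, not_false_eq_true,
      Pi.single_eq_of_ne, add_zero] at b0 b1
    rw [hinner]
    simp only [abs_lt]
    omega

/-- The faces of the vertical edge `s(x, x + e₁)` are `x` and `x - e₀`; both are inner faces of the
anchor data iff `-(L-1) ≤ s ≤ L-2` and `-(L-2) ≤ d ≤ L-1`. [folklore] -/
theorem faces_inner_iff_one (hδ : 0 < δ) (hLδ : (L : ℝ) * δ < 2) (hL1 : 2 ≤ ((L : ℝ) + 1) * δ)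
    (x : Site 2) :
    (∀ f : Site 2, IsCorner x f → IsCorner (x + Pi.single 1 1) f → (anchorData δ).IsInnerFace f) ↔
      -(L - 1) ≤ x 0 + x 1 ∧ x 0 + x 1 ≤ L - 2 ∧ -(L - 2) ≤ x 0 - x 1 ∧ x 0 - x 1 ≤ L - 1 := by
  have hinner := S5.isInnerFace_anchor_iff (E := anchorData δ) rfl rfl hδ hLδ hL1
  constructor
  · intro h
    have h1 := h x (isCorner_self x) (S5.anchor_isCorner_add_single x 1)
    have h2 := h (x - Pi.single 0 1) (fun j => by fin_cases j <;> simp)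
      (fun j => by fin_cases j <;> simp)
    rw [hinner] at h1 h2
    simp only [Pi.sub_apply, Pi.single_eq_same, ne_eq, one_ne_zero, not_false_eq_true,
      Pi.single_eq_of_ne, sub_zero] at h2
    simp only [abs_lt] at h1 h2
    omega
  · rintro ⟨h1, h2, h3, h4⟩ f hf hf'
    have a0 := hf 0
    have a1 := hf 1
    have b0 := hf' 0
    have b1 := hf' 1
    simp only [Pi.add_apply, Pi.single_eq_same, ne_eq, not_false_eq_true,
      Pi.single_eq_of_ne, zero_ne_one, add_zero] at b0 b1
    rw [hinner]
    simp only [abs_lt]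
    omega

/-! ## Random both-inner medial vertices of the anchor data, in coordinates -/

/-- **Horizontal random both-inner medial vertices of the anchor data**: `(x, 0)` is random-both-inner
iff both faces are inner (`-(L-1) ≤ s ≤ L-2`, `-(L-1) ≤ d ≤ L-2`) and the right endpoint `x + e₀` is
no `B`-site (`¬ (s = L-2 ∧ |d+1| ≤ L-3)`); the edge condition and the "not `A`–`A`" condition are then
automatic (parity). [folklore] -/
theorem isRandomMV_iff_zero (hδ : 0 < δ) (hLδ : (L : ℝ) * δ < 2) (hL1 : 2 ≤ ((L : ℝ) + 1) * δ)
    (hL : 4 ≤ L) (x : Site 2) :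
    IsRandomMV (anchorData δ) (x, 0) ↔
      (-(L - 1) ≤ x 0 + x 1 ∧ x 0 + x 1 ≤ L - 2 ∧ -(L - 1) ≤ x 0 - x 1 ∧ x 0 - x 1 ≤ L - 2) ∧
        ¬ (x 0 + x 1 = L - 2 ∧ |x 0 - x 1 + 1| ≤ L - 3) := by
  have hbd := S5.mem_zdBoundary_anchor_iff (E := anchorData δ) rfl rfl hδ (by omega) hLδ hL1
  have hA := AnchorLattice.mem_zdArcA_iff hδ hLδ hL1 hL
  have hB := AnchorLattice.mem_zdArcB_iff hδ hLδ hL1 hL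
  have hadj : (zdGraph 2).Adj x (x + Pi.single 0 1) := (zdGraph_adj_iff _ _).2 ⟨0, Or.inl rfl⟩
  simp only [IsRandomMV, medialVertexOf, SimpleGraph.mem_edgeSet, Sym2.forall_mem_pair,
    AnchorLattice.adj_iff hδ hLδ hL1, hA, hB, hbd, faces_inner_iff_zero hδ hLδ hL1, hadj, true_and]
  simp only [Pi.add_apply, Pi.single_eq_same, ne_eq, one_ne_zero, not_false_eq_true,
    Pi.single_eq_of_ne, add_zero]
  simp only [abs_le, le_abs']
  omega

/-- **Vertical random both-inner medial vertices of the anchor data**: `(x, 1)` is random-both-inner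
iff both faces are inner (`-(L-1) ≤ s ≤ L-2`, `-(L-2) ≤ d ≤ L-1`) and the upper endpoint `x + e₁` is
no `B`-site (`¬ (s = L-2 ∧ |d-1| ≤ L-3)`). [folklore] -/
theorem isRandomMV_iff_one (hδ : 0 < δ) (hLδ : (L : ℝ) * δ < 2) (hL1 : 2 ≤ ((L : ℝ) + 1) * δ)
    (hL : 4 ≤ L) (x : Site 2) :
    IsRandomMV (anchorData δ) (x, 1) ↔
      (-(L - 1) ≤ x 0 + x 1 ∧ x 0 + x 1 ≤ L - 2 ∧ -(L - 2) ≤ x 0 - x 1 ∧ x 0 - x 1 ≤ L - 1) ∧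
        ¬ (x 0 + x 1 = L - 2 ∧ |x 0 - x 1 - 1| ≤ L - 3) := by
  have hbd := S5.mem_zdBoundary_anchor_iff (E := anchorData δ) rfl rfl hδ (by omega) hLδ hL1
  have hA := AnchorLattice.mem_zdArcA_iff hδ hLδ hL1 hL
  have hB := AnchorLattice.mem_zdArcB_iff hδ hLδ hL1 hL
  have hadj : (zdGraph 2).Adj x (x + Pi.single 1 1) := (zdGraph_adj_iff _ _).2 ⟨1, Or.inl rfl⟩
  simp only [IsRandomMV, medialVertexOf, SimpleGraph.mem_edgeSet, Sym2.forall_mem_pair,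
    AnchorLattice.adj_iff hδ hLδ hL1, hA, hB, hbd, faces_inner_iff_one hδ hLδ hL1, hadj, true_and]
  simp only [Pi.add_apply, Pi.single_eq_same, ne_eq, not_false_eq_true,
    Pi.single_eq_of_ne, zero_ne_one, add_zero]
  simp only [abs_le, le_abs']
  omega

/-! ## The twin table -/

/-- The twin table at a horizontal medial vertex (`HalfCRGreen.twin x 0`, entrywise). [folklore] -/
theorem twin_zero (x : Site 2) : twin x 0 0 = (x, 1) ∧ twin x 0 1 = (x + Pi.single 0 1, 1) ∧
    twin x 0 2 = (x + Pi.single 0 1 - Pi.single 1 1, 1) ∧ twin x 0 3 = (x - Pi.single 1 1, 1) :=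
  ⟨rfl, rfl, rfl, rfl⟩

/-- The twin table at a vertical medial vertex (`HalfCRGreen.twin x 1`, entrywise). [folklore] -/
theorem twin_one (x : Site 2) : twin x 1 0 = (x - Pi.single 0 1 + Pi.single 1 1, 0) ∧
    twin x 1 1 = (x + Pi.single 1 1, 0) ∧ twin x 1 2 = (x, 0) ∧ twin x 1 3 = (x - Pi.single 0 1, 0) :=
  ⟨rfl, rfl, rfl, rfl⟩

end AnchorWall

open AnchorWall in
/-- **Registered sub-goal `stub_anchorWallClassification`** (of the stub `stub_anchorMoment_of_IP`, line
`strip-anchored-vertex-normalisation`, skeleton r4): for `0 < δ ≤ 1/8`, with `L = ⌈2/δ⌉ - 1`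
(`L δ < 2 ≤ (L + 1) δ`), every wall corner `(p, k)` of the concrete anchor data `anchorData δ` (`p` a
random both-inner medial vertex whose twin across the `k`-th corner is not) belongs to one of the eight
explicit families along the four sides of the lattice diamond — free side `s = +L`: `k = 1`, `s(p) = L-3`;
wired side `d = +L`: `k = 2`, `d(p) = L-2` (horizontal `p`) / `L-1` (vertical `p`); wired side
`d = -L`: `k = 0`, `d(p) = -(L-1)` (horizontal) / `-(L-2)` (vertical); wired side `s = -L`: `k = 3`,
`s(p) = -(L-1)` — or lies within distance `8` of one of its four vertices (`s = p₀ + p₁`, `d = p₀ - p₁`).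
By the coordinate description of the random both-inner vertices (`AnchorWall.isRandomMV_iff_zero/one`)
and `omega`. [folklore] -/
theorem stub_anchorWallClassification : ∀ δ : ℝ, 0 < δ → δ ≤ 1 / 8 → ∃ L : ℤ, (L : ℝ) * δ < 2 ∧ 2 ≤ ((L : ℝ) + 1) * δ ∧ ∀ (p : Site 2 × Fin 2) (k : Fin 4), IsRandomMV (anchorData δ) p → ¬ IsRandomMV (anchorData δ) (twin p.1 p.2 k) → (p.2 = 0 ∧ k = 1 ∧ p.1 0 + p.1 1 = L - 3 ∧ |p.1 0 - p.1 1| ≤ L - 5) ∨ (p.2 = 1 ∧ k = 1 ∧ p.1 0 + p.1 1 = L - 3 ∧ |p.1 0 - p.1 1| ≤ L - 5) ∨ (p.2 = 0 ∧ k = 2 ∧ p.1 0 - p.1 1 = L - 2 ∧ |p.1 0 + p.1 1| ≤ L - 4) ∨ (p.2 = 1 ∧ k = 2 ∧ p.1 0 - p.1 1 = L - 1 ∧ |p.1 0 + p.1 1| ≤ L - 4) ∨ (p.2 = 0 ∧ k = 0 ∧ p.1 0 - p.1 1 = -(L - 1) ∧ |p.1 0 + p.1 1| ≤ L - 4) ∨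 (p.2 = 1 ∧ k = 0 ∧ p.1 0 - p.1 1 = -(L - 2) ∧ |p.1 0 + p.1 1| ≤ L - 4) ∨ (p.2 = 0 ∧ k = 3 ∧ p.1 0 + p.1 1 = -(L - 1) ∧ |p.1 0 - p.1 1| ≤ L - 4) ∨ (p.2 = 1 ∧ k = 3 ∧ p.1 0 + p.1 1 = -(L - 1) ∧ |p.1 0 - p.1 1| ≤ L - 4) ∨ (L - 8 ≤ |p.1 0 + p.1 1| ∧ L - 8 ≤ |p.1 0 - p.1 1|) := by
  intro δ hδ hδ8
  obtain ⟨L, hL7, hLδ, hL1⟩ := AnchorLattice.exists_level hδ (by linarith)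
  have hL : 4 ≤ L := by omega
  refine ⟨L, hLδ, hL1, ?_⟩
  rintro ⟨x, i⟩ k hp hq
  obtain ⟨t0, t1, t2, t3⟩ := twin_zero x
  obtain ⟨u0, u1, u2, u3⟩ := twin_one x
  fin_cases i <;> fin_cases k
  all_goals simp only [t0, t1, t2, t3, u0, u1, u2, u3, Fin.isValue, Fin.zero_eta, Fin.mk_one,
    Fin.reduceFinMk] at hp hq ⊢
  -- the coordinate descriptions of `p` and of its twin
  all_goals first
    | rw [isRandomMV_iff_zero hδ hLδ hL1 hL] at hp
    | rw [isRandomMV_iff_one hδ hLδ hL1 hL] at hp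
  all_goals first
    | rw [isRandomMV_iff_zero hδ hLδ hL1 hL] at hq
    | rw [isRandomMV_iff_one hδ hLδ hL1 hL] at hq
  all_goals simp only [Pi.add_apply, Pi.sub_apply, Pi.single_eq_same, ne_eq, one_ne_zero, zero_ne_one,
    not_false_eq_true, Pi.single_eq_of_ne, add_zero, sub_zero, abs_le, le_abs', true_and, false_and,
    false_or, Fin.reduceEq] at hp hq ⊢
  all_goals omega

end Summit.CriticalPhenomena.CardyFormulaZ2.Theorems.ParafermionFamiliesToSLESix.StripAnchored

end
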